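import Literature.Analysis.FluidPDE.BesovLocalLimits
import Literature.Analysis.FluidPDE.CriticalSpacesTranslate
import Literature.Analysis.FluidPDE.CriticalBesovRescalingVanishing
import Literature.Analysis.FluidPDE.BoundedRepresentative
import Literature.Analysis.FluidPDE.Seregin2020BlowupLimit
import Literature.Analysis.FluidPDE.LerayPressureDecayReduction
import Literature.Analysis.FluidPDE.LocalTypeI
import HarnessLib

/-!
# The slices of a blow-up limit are represented by critical Besov distributions
# (Wang–Zhang 2017, §4 Step 1, (4.4): `‖v(t)‖_{Ḃ^{-1+3/p}_{p,q}} ≤ M`)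

Analysis/FluidPDE proofs-only file (theorems only: no definition, no named fact; nothing accepted
is restated or changed). W. Wang, Z. Zhang, *Blow-up of critical norms for the 3-D Navier–Stokes
equations*, Sci. China Math. 60 (2017) = arXiv:1510.02589, §4 Step 1: for the blow-up limit `v` of
the rescaled solutions `u^k`, "the lower semi-continuity of the norm gives (4.4)
`‖v‖_{L^∞(-a²,0; Ḃ^{-1+3/p}_{p,q})} ≤ M`". For the zoom blow-up limit `w` of the tree's extraction
`exists_zoom_blowup_limit` (strong `L³(Q(a))` convergence, every `a`) of a field `v` whose slices
`v(t)`, `t₀ - τ < t < t₀`, are represented by realised distributions of class `Ḃ^s_{p,q}` with norm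
`≤ M` (`s = -1 + 3/p`, `-2 < s < 0`, `q ≠ 0`), and which has `A(r; z)[w] ≤ K` at all apices
`z.1 ≤ 0` (`BlowupLimitBounds.blowup_cknAEss_le_apex`), this file proves: for a.e. `t < 0`, the
slice `w(t)` is uniformly locally square integrable and is represented by a realised distribution
`W_t ∈ Ḃ^s_{p,q}` with `‖W_t‖ ≤ M` (`blowup_ae_slice_memHomBesov`) — the hypothesis shape of
`ae_liouville_of_ae_uloc_of_ae_memHomBesov` (`BesovSliceLiouville.lean`).

Proof: along a subsequence the slices converge in `L³(B_a)` for a.e. `t` and every `a`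
(summable subsequence of the `L³(Q(a))` distances, Tonelli, diagonal in `a`); each rescaled slice
`μ v(t₀ + μ²t, x₀ + μ·)` is represented by the zoom `rescaleDistrib μ (τ_{-x₀} V)` with the same
critical norm (`IsDistributionOf.rescaleData_translate_add`, `eHomBesovNorm_zoom_eq`,
`memHomBesov_zoom`; the scales `μ_j = 2^{-(δ(j)+2)}` are dyadic); the limit slice is measurable,
uniformly locally `L²` (from the `A` bounds, a.e. in `t`), hence pairs integrably with Schwartz
functions (far-field summation `exists_farField_tail_le`); and
`exists_tendsto_isDistributionOf_of_tendsto_integral` (`BesovLocalLimits.lean`) identifies the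
weak-`*` limit of the zoomed distributions with the distribution of `w(t)`.

## References

* W. Wang, Z. Zhang, Sci. China Math. 60 (2017) 637–650 = arXiv:1510.02589, §4 Step 1, (4.4).
  [WangZhang2016]
* H. Bahouri, J.-Y. Chemin, R. Danchin, *Fourier Analysis and Nonlinear PDE* (2011), Thm. 2.25,
  Prop. 2.18. [BahouriCheminDanchin2011]
-/

noncomputable section

open MeasureTheory Set Function Filter Topology TopologicalSpace Metric
open scoped NNReal ENNReal SchwartzMap

namespace Literature.Analysis.FluidPDE

open FunctionSpaces.EuclideanSpace (complexify)

/-! ### Uniformly locally `L²` fields pair integrably with Schwartz functions -/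

section Uloc

/-- **A uniformly locally square integrable field pairs integrably with every Schwartz
function**: if `∫_{B(z,1)} |w|² ≤ A < ∞` for all `z`, then `θ • complexify ∘ w ∈ L¹` for Schwartz
`θ` (near field by Cauchy–Schwarz on `B(0,2)`; far field by `|θ||w| ≤ (|θ|² |y|⁴ + |w|² |y|⁻⁴)/2`
and the far-field summation `exists_farField_tail_le`). [folklore] -/
theorem integrable_schwartz_smul_complexify_of_uloc
    {w : EuclideanSpace ℝ (Fin 3) → EuclideanSpace ℝ (Fin 3)} (hwm : AEStronglyMeasurable w volume)
    {A : ℝ≥0∞} (hAtop : A ≠ ⊤)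
    (hA : ∀ z : EuclideanSpace ℝ (Fin 3), ∫⁻ y in ball z 1, ‖w y‖ₑ ^ 2 ≤ A)
    (θ : 𝓢(EuclideanSpace ℝ (Fin 3), ℂ)) :
    Integrable (fun x => θ x • complexify (w x)) := by
  obtain ⟨K, hKtop, hK⟩ := exists_farField_tail_le (r := 1) one_pos
  have hsm : AEStronglyMeasurable (fun x => θ x • complexify (w x)) volume :=
    θ.continuous.aestronglyMeasurable.smul
      (FunctionSpaces.EuclideanSpace.continuous_complexify.comp_aestronglyMeasurable hwm)
  refine ⟨hsm, ?_⟩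
  -- `∫ ‖θ‖ ‖w‖ < ∞`: split at `B(0, 2)`
  have hnorm : ∀ x, ‖θ x • complexify (w x)‖ₑ = ‖θ x‖ₑ * ‖w x‖ₑ := fun x => by
    rw [enorm_smul, ← ofReal_norm, ← ofReal_norm, ← ofReal_norm (w x),
      FunctionSpaces.EuclideanSpace.norm_complexify]
  rw [hasFiniteIntegral_iff_enorm]
  simp_rw [hnorm]
  set B : Set (EuclideanSpace ℝ (Fin 3)) := ball 0 2 with hB
  have hsplit : ∫⁻ x, ‖θ x‖ₑ * ‖w x‖ₑ = (∫⁻ x in B, ‖θ x‖ₑ * ‖w x‖ₑ) + ∫⁻ x in Bᶜ, ‖θ x‖ₑ * ‖w x‖ₑ :=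
    (lintegral_add_compl _ measurableSet_ball).symm
  rw [hsplit]
  refine ENNReal.add_lt_top.2 ⟨?_, ?_⟩
  · -- near field: `‖θ‖ ≤ C₀`, Cauchy–Schwarz on the ball of radius 2 (covered by unit balls? use
    -- `2 ab ≤ a² + b²` instead)
    obtain ⟨C₀, hC₀⟩ : ∃ C₀ : ℝ, ∀ x, ‖θ x‖ ≤ C₀ := by
      obtain ⟨C, -, hC⟩ := θ.decay 0 0
      exact ⟨C, fun x => by simpa using hC x⟩
    have hpt : ∀ x, ‖θ x‖ₑ * ‖w x‖ₑ ≤ ENNReal.ofReal (C₀ ^ 2) + ‖w x‖ₑ ^ 2 := by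
      intro x
      have h1 : ‖θ x‖ₑ ≤ ENNReal.ofReal C₀ := by
        rw [← ofReal_norm]; exact ENNReal.ofReal_le_ofReal (hC₀ x)
      calc ‖θ x‖ₑ * ‖w x‖ₑ ≤ ENNReal.ofReal C₀ * ‖w x‖ₑ := mul_le_mul' h1 le_rfl
        _ ≤ ENNReal.ofReal C₀ ^ 2 + ‖w x‖ₑ ^ 2 := by
            rcases le_total (ENNReal.ofReal C₀) ‖w x‖ₑ with h | h
            · calc ENNReal.ofReal C₀ * ‖w x‖ₑ ≤ ‖w x‖ₑ * ‖w x‖ₑ := mul_le_mul' h le_rfl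
                _ = ‖w x‖ₑ ^ 2 := (sq _).symm
                _ ≤ _ := le_add_self
            · calc ENNReal.ofReal C₀ * ‖w x‖ₑ ≤ ENNReal.ofReal C₀ * ENNReal.ofReal C₀ :=
                    mul_le_mul' le_rfl h
                _ = ENNReal.ofReal C₀ ^ 2 := (sq _).symm
                _ ≤ _ := le_self_add
        _ = ENNReal.ofReal (C₀ ^ 2) + ‖w x‖ₑ ^ 2 := by
            rw [ENNReal.ofReal_pow (le_trans (norm_nonneg _) (hC₀ 0))]
    -- the ball of radius `2` is covered by finitely many... simpler: `B(0,2) ⊆ ⋃` of 4³ unit balls;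
    -- we avoid the covering by bounding `∫_{B(0,2)} |w|²` through `8` unit balls along a net? Use instead
    -- the far-field lemma with radius... Directly: `B(0,2) ⊆ B(0,1) ∪ (B(0,1)ᶜ ∩ B(0,2))` is not helpful.
    -- We use the unit balls centred at the points of a finite `1`-net of `closedBall 0 2`.
    obtain ⟨N, -, hNfin, hNcover⟩ :
        ∃ N : Set (EuclideanSpace ℝ (Fin 3)), N ⊆ closedBall (0 : EuclideanSpace ℝ (Fin 3)) 2 ∧
          N.Finite ∧ closedBall (0 : EuclideanSpace ℝ (Fin 3)) 2 ⊆ ⋃ z ∈ N, ball z 1 :=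
      (isCompact_closedBall (0 : EuclideanSpace ℝ (Fin 3)) 2).finite_cover_balls one_pos
    haveI : Fintype N := hNfin.fintype
    have hcover : B ⊆ ⋃ z : N, ball (z : EuclideanSpace ℝ (Fin 3)) 1 := by
      intro x hx
      have hx' := hNcover (ball_subset_closedBall hx)
      simp only [mem_iUnion] at hx' ⊢
      obtain ⟨z, hz, hxz⟩ := hx'
      exact ⟨⟨z, hz⟩, hxz⟩
    calc ∫⁻ x in B, ‖θ x‖ₑ * ‖w x‖ₑ ≤ ∫⁻ x in B, (ENNReal.ofReal (C₀ ^ 2) + ‖w x‖ₑ ^ 2) :=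
          lintegral_mono fun x => hpt x
      _ = ENNReal.ofReal (C₀ ^ 2) * volume B + ∫⁻ x in B, ‖w x‖ₑ ^ 2 := by
          rw [lintegral_add_left measurable_const, setLIntegral_const]
      _ ≤ ENNReal.ofReal (C₀ ^ 2) * volume B + ∑' z : N, ∫⁻ x in ball (z : EuclideanSpace ℝ (Fin 3)) 1,
            ‖w x‖ₑ ^ 2 := by
          gcongr
          exact (lintegral_mono_set hcover).trans (lintegral_iUnion_le _ _)
      _ ≤ ENNReal.ofReal (C₀ ^ 2) * volume B + ∑' _z : N, A := by
          gcongr with z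
          exact hA _
      _ < ⊤ := by
          refine ENNReal.add_lt_top.2 ⟨ENNReal.mul_lt_top ENNReal.ofReal_lt_top measure_ball_lt_top, ?_⟩
          rw [tsum_fintype, Finset.sum_const, Finset.card_univ, nsmul_eq_mul]
          exact ENNReal.mul_lt_top (by simp) hAtop.lt_top
  · -- far field: Cauchy–Schwarz with the weights `‖x‖²`, `‖x‖⁻²`
    obtain ⟨C₂, hC₂⟩ : ∃ C₂ : ℝ, ∀ x, ‖x‖ ^ 2 * ‖θ x‖ ≤ C₂ := by
      obtain ⟨C, -, hC⟩ := θ.decay 2 0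
      exact ⟨C, fun x => by simpa using hC x⟩
    have hC₂0 : 0 ≤ C₂ := le_trans (by positivity) (hC₂ 0)
    set f : EuclideanSpace ℝ (Fin 3) → ℝ≥0∞ := fun x => ‖θ x‖ₑ * ENNReal.ofReal (‖x‖ ^ 2) with hf
    set g : EuclideanSpace ℝ (Fin 3) → ℝ≥0∞ := fun x => ‖w x‖ₑ * ENNReal.ofReal ((‖x‖ ^ 2)⁻¹) with hg
    have hfg : ∀ x ∈ Bᶜ, ‖θ x‖ₑ * ‖w x‖ₑ = f x * g x := by
      intro x hx
      rw [hB, mem_compl_iff, mem_ball, dist_zero_right, not_lt] at hx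
      have hx2 : 0 < ‖x‖ ^ 2 := by positivity
      rw [hf, hg]
      dsimp only
      rw [mul_mul_mul_comm, ← ENNReal.ofReal_mul hx2.le, mul_inv_cancel₀ hx2.ne', ENNReal.ofReal_one,
        mul_one]
    have hfm : AEMeasurable f (volume.restrict Bᶜ) :=
      (θ.continuous.aestronglyMeasurable.aemeasurable.enorm.mul
        ((continuous_norm.pow 2).measurable.ennreal_ofReal).aemeasurable).restrict
    have hgm : AEMeasurable g (volume.restrict Bᶜ) :=
      (hwm.aemeasurable.enorm.mul
        (((continuous_norm.pow 2).measurable.inv).ennreal_ofReal).aemeasurable).restrict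
    have hH := ENNReal.lintegral_mul_le_Lp_mul_Lq (volume.restrict Bᶜ)
      (Real.holderConjugate_iff.2 ⟨by norm_num, by norm_num⟩ : (2 : ℝ).HolderConjugate 2) hfm hgm
    -- `∫ f² < ∞`
    have hf2 : ∫⁻ x in Bᶜ, f x ^ (2 : ℝ) < ⊤ := by
      have hpt : ∀ x, f x ^ (2 : ℝ) ≤ ENNReal.ofReal C₂ * (‖θ x‖ₑ * ENNReal.ofReal (‖x‖ ^ 2)) := by
        intro x
        rw [show (2 : ℝ) = ((2 : ℕ) : ℝ) by norm_num, ENNReal.rpow_natCast, sq, hf]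
        dsimp only
        refine mul_le_mul' ?_ le_rfl
        rw [← ofReal_norm, ← ENNReal.ofReal_mul (norm_nonneg _)]
        refine ENNReal.ofReal_le_ofReal ?_
        rw [mul_comm]; exact hC₂ x
      have hint : Integrable (fun x => ‖x‖ ^ 2 * ‖θ x‖) := θ.integrable_pow_mul volume 2
      calc ∫⁻ x in Bᶜ, f x ^ (2 : ℝ) ≤ ∫⁻ x in Bᶜ, ENNReal.ofReal C₂ * (‖θ x‖ₑ * ENNReal.ofReal (‖x‖ ^ 2)) :=
            lintegral_mono fun x => hpt x
        _ ≤ ∫⁻ x, ENNReal.ofReal C₂ * (‖θ x‖ₑ * ENNReal.ofReal (‖x‖ ^ 2)) :=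
            setLIntegral_le_lintegral _ _
        _ = ENNReal.ofReal C₂ * ∫⁻ x, ‖θ x‖ₑ * ENNReal.ofReal (‖x‖ ^ 2) := by
            rw [lintegral_const_mul' _ _ ENNReal.ofReal_ne_top]
        _ < ⊤ := by
            refine ENNReal.mul_lt_top ENNReal.ofReal_lt_top ?_
            have e : ∀ x, ‖θ x‖ₑ * ENNReal.ofReal (‖x‖ ^ 2) = ‖‖x‖ ^ 2 * ‖θ x‖‖ₑ := fun x => by
              rw [Real.enorm_eq_ofReal (by positivity), ENNReal.ofReal_mul (by positivity), ofReal_norm,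
                mul_comm]
            simp_rw [e]
            exact hint.2
    -- `∫_{Bᶜ} g² < ∞` by the far-field summation
    have hg2 : ∫⁻ x in Bᶜ, g x ^ (2 : ℝ) < ⊤ := by
      have e : ∀ x, g x ^ (2 : ℝ) = ‖w x‖ₑ ^ 2 * ENNReal.ofReal ((‖x - 0‖ ^ 4)⁻¹) := fun x => by
        rw [show (2 : ℝ) = ((2 : ℕ) : ℝ) by norm_num, ENNReal.rpow_natCast, hg]
        dsimp only
        have e4 : ((‖x‖ ^ 2)⁻¹) ^ 2 = (‖x‖ ^ 4)⁻¹ := by rw [inv_pow, ← pow_mul]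
        rw [mul_pow, ← ENNReal.ofReal_pow (by positivity), e4, sub_zero]
      simp_rw [e]
      have h := hK (fun y => ‖w y‖ₑ ^ 2) (hwm.aemeasurable.enorm.pow_const 2) A hA 0 2 (by norm_num)
      refine lt_of_le_of_lt h ?_
      exact ENNReal.mul_lt_top (ENNReal.mul_lt_top hKtop.lt_top ENNReal.ofReal_lt_top) hAtop.lt_top
    calc ∫⁻ x in Bᶜ, ‖θ x‖ₑ * ‖w x‖ₑ = ∫⁻ x in Bᶜ, f x * g x :=
          setLIntegral_congr_fun measurableSet_ball.compl hfg
      _ ≤ (∫⁻ x in Bᶜ, f x ^ (2 : ℝ)) ^ (1 / (2 : ℝ)) * (∫⁻ x in Bᶜ, g x ^ (2 : ℝ)) ^ (1 / (2 : ℝ)) := hH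
      _ < ⊤ := ENNReal.mul_lt_top (ENNReal.rpow_lt_top_of_nonneg (by norm_num) hf2.ne)
          (ENNReal.rpow_lt_top_of_nonneg (by norm_num) hg2.ne)

end Uloc

/-! ### Uniform local square integrability of the slices from the `A` bounds -/

section UlocSlices

/-- **From `A(R; (0,x)) ≤ K` at all `x` to uniformly locally `L²` slices, a.e. in time**: for
`R ≥ 3`, for a.e. `t ∈ ]-R², 0[`, `∫_{B̄(y,2)} |w(t)|² ≤ R K` for every `y` (countable dense set of
centres, `B̄(y,2) ⊆ B(x,3) ⊆ B(x,R)` for `dist(x,y) < 1`). [folklore] -/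
theorem ae_forall_lintegral_closedBall_sq_le_of_cknAEss
    {w : ℝ → EuclideanSpace ℝ (Fin 3) → EuclideanSpace ℝ (Fin 3)} {K : ℝ≥0} {R : ℝ} (hR : 3 ≤ R)
    (hA : ∀ x : EuclideanSpace ℝ (Fin 3), cknAEss R ((0 : ℝ), x) w ≤ K) :
    ∀ᵐ t ∂(volume.restrict (Ioo (-R ^ 2) 0)), ∀ y : EuclideanSpace ℝ (Fin 3),
      ∫⁻ z in closedBall y 2, ‖w t z‖ₑ ^ 2 ≤ ENNReal.ofReal R * K := by
  obtain ⟨D, hDc, hDd⟩ := TopologicalSpace.exists_countable_dense (EuclideanSpace ℝ (Fin 3))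
  have hRpos : 0 < R := by linarith
  have hR0 : ENNReal.ofReal R ≠ 0 := (ENNReal.ofReal_pos.2 hRpos).ne'
  -- for each centre `x ∈ D`, a.e. in `t`
  have hx : ∀ x ∈ D, ∀ᵐ t ∂(volume.restrict (Ioo (-R ^ 2) 0)),
      ∫⁻ z in ball x R, ‖w t z‖ₑ ^ 2 ≤ ENNReal.ofReal R * K := by
    intro x _
    have h1 := ENNReal.ae_le_essSup
      (fun t : ℝ => (ENNReal.ofReal R)⁻¹ * ∫⁻ z in ball x R, ‖w t z‖ₑ ^ 2)
      (μ := volume.restrict (Ioo ((0 : ℝ) - R ^ 2) 0))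
    have h2 : essSup (fun t : ℝ => (ENNReal.ofReal R)⁻¹ * ∫⁻ z in ball x R, ‖w t z‖ₑ ^ 2)
        (volume.restrict (Ioo ((0 : ℝ) - R ^ 2) 0)) ≤ K := hA x
    rw [zero_sub] at h1 h2
    filter_upwards [h1] with t ht
    have h3 := ht.trans h2
    calc ∫⁻ z in ball x R, ‖w t z‖ₑ ^ 2
        = ENNReal.ofReal R * ((ENNReal.ofReal R)⁻¹ * ∫⁻ z in ball x R, ‖w t z‖ₑ ^ 2) := by
          rw [← mul_assoc, ENNReal.mul_inv_cancel hR0 ENNReal.ofReal_ne_top, one_mul]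
      _ ≤ ENNReal.ofReal R * K := mul_le_mul' le_rfl h3
  have hall : ∀ᵐ t ∂(volume.restrict (Ioo (-R ^ 2) 0)), ∀ x ∈ D,
      ∫⁻ z in ball x R, ‖w t z‖ₑ ^ 2 ≤ ENNReal.ofReal R * K := (ae_ball_iff hDc).2 hx
  filter_upwards [hall] with t ht y
  -- a centre `x ∈ D` with `dist x y < 1`
  obtain ⟨x, hxD, hxy⟩ : ∃ x ∈ D, dist x y < 1 := by
    have h := hDd.exists_dist_lt y one_pos
    obtain ⟨x, hxD, hd⟩ := h
    exact ⟨x, hxD, by rw [dist_comm]; exact hd⟩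
  have hsub : closedBall y 2 ⊆ ball x R := by
    intro z hz
    rw [mem_closedBall] at hz
    rw [mem_ball]
    calc dist z x ≤ dist z y + dist y x := dist_triangle _ _ _
      _ < 2 + 1 := by rw [dist_comm y x]; linarith
      _ ≤ R := by linarith
  exact (lintegral_mono_set hsub).trans (ht x hxD)

end UlocSlices

/-! ### A.e. convergence of the slices along a subsequence -/

section Subsequence

/-- **A subsequence along which the slices converge, a.e. in time, on every ball**: if
`U_j → w` in `L³(Q(a))` for every `a > 0` (`Q(a) = ]-a², 0[ × B(0,a)`), then along a strictly
increasing `φ`, for every `n`, for a.e. `t ∈ ]-(n+1)², 0[`,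
`∫_{B(0,n+1)} |U_{φ(k)}(t) - w(t)|³ → 0` (summable subsequence of the `L³` distances, Tonelli).
[folklore] -/
theorem exists_strictMono_ae_tendsto_slices
    {U : ℕ → ℝ → EuclideanSpace ℝ (Fin 3) → EuclideanSpace ℝ (Fin 3)}
    {w : ℝ → EuclideanSpace ℝ (Fin 3) → EuclideanSpace ℝ (Fin 3)}
    (hUm : ∀ a : ℝ, 0 < a → ∃ j₀ : ℕ, ∀ j, j₀ ≤ j → AEStronglyMeasurable (uncurry (U j))
      (volume.restrict (parabolicCylinder a (0 : ℝ × EuclideanSpace ℝ (Fin 3)))))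
    (hwm : ∀ a : ℝ, 0 < a → AEStronglyMeasurable (uncurry w)
      (volume.restrict (parabolicCylinder a (0 : ℝ × EuclideanSpace ℝ (Fin 3)))))
    (hconv : ∀ a : ℝ, 0 < a → Tendsto (fun j => eLpNorm (uncurry (U j) - uncurry w) 3
      (volume.restrict (parabolicCylinder a (0 : ℝ × EuclideanSpace ℝ (Fin 3))))) atTop (𝓝 0)) :
    ∃ φ : ℕ → ℕ, StrictMono φ ∧ ∀ n : ℕ,
      ∀ᵐ t ∂(volume.restrict (Ioo (-((n : ℝ) + 1) ^ 2) 0)),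
        Tendsto (fun k => ∫⁻ x in ball (0 : EuclideanSpace ℝ (Fin 3)) ((n : ℝ) + 1),
          ‖U (φ k) t x - w t x‖ₑ ^ (3 : ℕ)) atTop (𝓝 0) := by
  classical
  have hnpos : ∀ n : ℕ, (0 : ℝ) < (n : ℝ) + 1 := fun n => by positivity
  choose jm hjm using fun n : ℕ => hUm _ (hnpos n)
  -- the slice distances (cut off before measurability sets in) and their time integrals
  set G₀ : ℕ → ℕ → ℝ → ℝ≥0∞ := fun n j t =>
    ∫⁻ x in ball (0 : EuclideanSpace ℝ (Fin 3)) ((n : ℝ) + 1), ‖U j t x - w t x‖ₑ ^ (3 : ℕ) with hG₀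
  set G : ℕ → ℕ → ℝ → ℝ≥0∞ := fun n j => if jm n ≤ j then G₀ n j else fun _ => 0 with hG
  have hGeq : ∀ n j, jm n ≤ j → G n j = G₀ n j := fun n j hj => by rw [hG]; dsimp only; rw [if_pos hj]
  set F : ℕ → ℕ → ℝ≥0∞ := fun n j => ∫⁻ t in Ioo (-((n : ℝ) + 1) ^ 2) 0, G n j t with hF
  have hQ : ∀ n : ℕ, parabolicCylinder ((n : ℝ) + 1) (0 : ℝ × EuclideanSpace ℝ (Fin 3)) =
      Ioo (-((n : ℝ) + 1) ^ 2) 0 ×ˢ ball (0 : EuclideanSpace ℝ (Fin 3)) ((n : ℝ) + 1) := fun n => by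
    rw [parabolicCylinder]; simp
  have hDm : ∀ (n : ℕ) (j : ℕ), jm n ≤ j →
      AEMeasurable (fun q : ℝ × EuclideanSpace ℝ (Fin 3) => ‖U j q.1 q.2 - w q.1 q.2‖ₑ ^ (3 : ℕ))
      ((volume.restrict (Ioo (-((n : ℝ) + 1) ^ 2) 0)).prod
        (volume.restrict (ball (0 : EuclideanSpace ℝ (Fin 3)) ((n : ℝ) + 1)))) := by
    intro n j hj
    rw [Measure.prod_restrict, ← Measure.volume_eq_prod, ← hQ n]
    exact (((hjm n j hj).sub (hwm _ (hnpos n))).aemeasurable.enorm.pow_const _)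
  have hGm : ∀ (n : ℕ) (j : ℕ), AEMeasurable (G n j) (volume.restrict (Ioo (-((n : ℝ) + 1) ^ 2) 0)) := by
    intro n j
    by_cases hj : jm n ≤ j
    · rw [hGeq n j hj]; exact (hDm n j hj).lintegral_prod_right'
    · rw [hG]; dsimp only; rw [if_neg hj]; exact aemeasurable_const
  -- `F n j = ‖U_j - w‖³_{L³(Q(n+1))}` for `j ≥ jm n`, hence `F n j → 0`
  have hFeq : ∀ (n : ℕ) (j : ℕ), jm n ≤ j → F n j = eLpNorm (uncurry (U j) - uncurry w) 3
      (volume.restrict (parabolicCylinder ((n : ℝ) + 1) (0 : ℝ × EuclideanSpace ℝ (Fin 3)))) ^ (3 : ℝ) := by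
    intro n j hj
    rw [eLpNorm_eq_lintegral_rpow_enorm_toReal (by norm_num) (by norm_num), ENNReal.toReal_ofNat,
      ← ENNReal.rpow_mul, show (1 / (3 : ℝ)) * 3 = 1 by norm_num, ENNReal.rpow_one, hQ,
      Measure.volume_eq_prod, ← Measure.prod_restrict, lintegral_prod _ (by
        have h := hDm n j hj
        have e : (fun q : ℝ × EuclideanSpace ℝ (Fin 3) => ‖(uncurry (U j) - uncurry w) q‖ₑ ^ (3 : ℝ)) =
            fun q => ‖U j q.1 q.2 - w q.1 q.2‖ₑ ^ (3 : ℕ) := by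
          funext q
          rw [← ENNReal.rpow_natCast]
          norm_num
          rfl
        rw [e]; exact h)]
    rw [hF]
    dsimp only
    rw [hGeq n j hj, hG₀]
    refine lintegral_congr fun t => lintegral_congr fun x => ?_
    rw [← ENNReal.rpow_natCast]
    norm_num
  have hF0 : ∀ n, Tendsto (fun j => F n j) atTop (𝓝 0) := by
    intro n
    have h := ((ENNReal.continuous_rpow_const (y := (3 : ℝ))).tendsto 0).comp (hconv _ (hnpos n))
    rw [ENNReal.zero_rpow_of_pos (by norm_num)] at h
    refine h.congr' ?_
    filter_upwards [eventually_ge_atTop (jm n)] with j hj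
    rw [Function.comp_apply, hFeq n j hj]
  -- ### the subsequence: `F n (φ k) ≤ 2^{-k}` for all `n ≤ k`
  set ε : ℕ → ℝ≥0∞ := fun k => (2⁻¹ : ℝ≥0∞) ^ k with hε
  have hεpos : ∀ k, 0 < ε k := fun k => ENNReal.pow_pos (by simp) k
  have hstage : ∀ k m : ℕ, ∃ j : ℕ, m < j ∧ ∀ n, n ≤ k → F n j ≤ ε k := by
    intro k m
    have h1 : ∀ᶠ j in atTop, ∀ n ∈ Finset.range (k + 1), F n j ≤ ε k := by
      rw [Finset.eventually_all]
      intro n _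
      exact ((tendsto_order.1 (hF0 n)).2 (ε k) (hεpos k)).mono fun j hj => hj.le
    obtain ⟨j, hj⟩ := (h1.and (eventually_gt_atTop m)).exists
    exact ⟨j, hj.2, fun n hn => hj.1 n (Finset.mem_range.2 (Nat.lt_succ_of_le hn))⟩
  choose nxt hnxt_gt hnxt_le using hstage
  set φ : ℕ → ℕ := fun k => Nat.rec (nxt 0 0) (fun k j => nxt (k + 1) j) k with hφdef
  have hφ0 : φ 0 = nxt 0 0 := rfl
  have hφsucc : ∀ k, φ (k + 1) = nxt (k + 1) (φ k) := fun k => rfl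
  have hφmono : StrictMono φ := strictMono_nat_of_lt_succ fun k => by
    rw [hφsucc]; exact hnxt_gt _ _
  have hφle : ∀ k n, n ≤ k → F n (φ k) ≤ ε k := by
    intro k
    induction k with
    | zero => intro n hn; rw [hφ0]; exact hnxt_le 0 0 n hn
    | succ k _ => intro n hn; rw [hφsucc]; exact hnxt_le (k + 1) (φ k) n hn
  refine ⟨φ, hφmono, fun n => ?_⟩
  -- ### for fixed `n`: `∑_k F n (φ (k + n)) < ∞`, hence a.e. convergence of the slices
  have hsum : ∑' k, F n (φ (k + n)) ≤ ∑' k, ε k := by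
    refine ENNReal.tsum_le_tsum fun k => (hφle (k + n) n (Nat.le_add_left n k)).trans ?_
    exact pow_le_pow_right_of_le_one' (by simp) (Nat.le_add_right k n)
  have hεsum : ∑' k, ε k < ⊤ := by
    rw [hε, ENNReal.tsum_geometric, ENNReal.one_sub_inv_two, inv_inv]
    exact ENNReal.ofNat_lt_top
  have hint : ∫⁻ t in Ioo (-((n : ℝ) + 1) ^ 2) 0, ∑' k, G n (φ (k + n)) t < ⊤ := by
    rw [lintegral_tsum fun k => hGm n (φ (k + n))]
    exact (hsum.trans_lt hεsum)
  have hae : ∀ᵐ t ∂(volume.restrict (Ioo (-((n : ℝ) + 1) ^ 2) 0)), ∑' k, G n (φ (k + n)) t < ⊤ :=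
    ae_lt_top' (AEMeasurable.tsum fun k => hGm n (φ (k + n))) hint.ne
  filter_upwards [hae] with t ht
  have h1 : Tendsto (fun k => G n (φ (k + n)) t) atTop (𝓝 0) :=
    ENNReal.tendsto_atTop_zero_of_tsum_ne_top ht.ne
  have h2 : Tendsto (fun k => G n (φ k) t) atTop (𝓝 0) :=
    (tendsto_add_atTop_iff_nat (f := fun k => G n (φ k) t) n).1 h1
  refine h2.congr' ?_
  filter_upwards [eventually_ge_atTop (jm n)] with k hk
  rw [hGeq n (φ k) (hk.trans (hφmono.id_le k))]

end Subsequence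

/-! ### Local `L³` convergence of slices gives convergence of compactly supported pairings -/

section Pairing

/-- **Local `L³` convergence implies convergence of the pairings with a test function supported
in the ball**: `‖∫ θ • (u_k - w)‖ ≤ ‖θ‖_∞ |B|^{2/3} ‖u_k - w‖_{L³(B)} → 0`. [folklore] -/
theorem tendsto_integral_smul_complexify_of_tendsto_lintegral_ball
    {u : ℕ → EuclideanSpace ℝ (Fin 3) → EuclideanSpace ℝ (Fin 3)}
    {w : EuclideanSpace ℝ (Fin 3) → EuclideanSpace ℝ (Fin 3)} {a : ℝ}
    (θ : 𝓢(EuclideanSpace ℝ (Fin 3), ℂ))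
    (hθ : tsupport (θ : EuclideanSpace ℝ (Fin 3) → ℂ) ⊆ ball (0 : EuclideanSpace ℝ (Fin 3)) a)
    (hu : ∀ k, Integrable (fun x => θ x • complexify (u k x)))
    (hw : Integrable (fun x => θ x • complexify (w x)))
    (hum : ∀ k, AEStronglyMeasurable (u k) (volume.restrict (ball (0 : EuclideanSpace ℝ (Fin 3)) a)))
    (hwm : AEStronglyMeasurable w (volume.restrict (ball (0 : EuclideanSpace ℝ (Fin 3)) a)))
    (hconv : Tendsto (fun k => ∫⁻ x in ball (0 : EuclideanSpace ℝ (Fin 3)) a,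
      ‖u k x - w x‖ₑ ^ (3 : ℕ)) atTop (𝓝 0)) :
    Tendsto (fun k => ∫ x, θ x • complexify (u k x)) atTop
      (𝓝 (∫ x, θ x • complexify (w x))) := by
  set B : Set (EuclideanSpace ℝ (Fin 3)) := ball 0 a with hB
  obtain ⟨C₀, hC₀⟩ : ∃ C₀ : ℝ, ∀ x, ‖θ x‖ ≤ C₀ := by
    obtain ⟨C, -, hC⟩ := θ.decay 0 0
    exact ⟨C, fun x => by simpa using hC x⟩
  have hC₀0 : 0 ≤ C₀ := le_trans (norm_nonneg _) (hC₀ 0)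
  -- the bound `‖∫ θ • (u_k - w)‖ₑ ≤ C₀ |B|^{2/3} (∫_B |u_k - w|³)^{1/3}`
  set L : ℕ → ℝ≥0∞ := fun k => ∫⁻ x in B, ‖u k x - w x‖ₑ ^ (3 : ℕ) with hL
  set bnd : ℕ → ℝ≥0∞ := fun k => ENNReal.ofReal C₀ * (volume B ^ (2 / 3 : ℝ) * L k ^ (1 / 3 : ℝ))
    with hbnd
  have hkey : ∀ k, ‖(∫ x, θ x • complexify (u k x)) - ∫ x, θ x • complexify (w x)‖ₑ ≤ bnd k := by
    intro k
    rw [← integral_sub (hu k) hw]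
    refine (enorm_integral_le_lintegral_enorm _).trans ?_
    have hpt : ∀ x, ‖θ x • complexify (u k x) - θ x • complexify (w x)‖ₑ = ‖θ x‖ₑ * ‖u k x - w x‖ₑ := by
      intro x
      rw [← smul_sub, ← map_sub, enorm_smul, ← ofReal_norm (complexify _),
        FunctionSpaces.EuclideanSpace.norm_complexify, ofReal_norm]
    simp_rw [hpt]
    -- the integrand vanishes off `B`
    have hzero : ∀ x ∈ Bᶜ, ‖θ x‖ₑ * ‖u k x - w x‖ₑ = 0 := by
      intro x hx
      have : θ x = 0 := image_eq_zero_of_notMem_tsupport fun h => hx (hθ h)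
      rw [this, enorm_zero, zero_mul]
    rw [← lintegral_add_compl _ measurableSet_ball, setLIntegral_congr_fun measurableSet_ball.compl hzero,
      lintegral_zero, add_zero]
    -- Hölder on `B`
    have hfm : AEMeasurable (fun x => ‖u k x - w x‖ₑ) (volume.restrict B) :=
      ((hum k).sub hwm).aemeasurable.enorm
    have hH := ENNReal.lintegral_mul_le_Lp_mul_Lq (volume.restrict B)
      (Real.holderConjugate_iff.2 ⟨by norm_num, by norm_num⟩ : (3 : ℝ).HolderConjugate (3 / 2))
      hfm (g := fun _ => (1 : ℝ≥0∞)) aemeasurable_const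
    simp only [Pi.mul_apply, mul_one, ENNReal.one_rpow, lintegral_const, Measure.restrict_apply_univ,
      one_mul] at hH
    calc ∫⁻ x in B, ‖θ x‖ₑ * ‖u k x - w x‖ₑ ≤ ∫⁻ x in B, ENNReal.ofReal C₀ * ‖u k x - w x‖ₑ := by
          refine lintegral_mono fun x => mul_le_mul' ?_ le_rfl
          rw [← ofReal_norm]; exact ENNReal.ofReal_le_ofReal (hC₀ x)
      _ = ENNReal.ofReal C₀ * ∫⁻ x in B, ‖u k x - w x‖ₑ := by
          rw [lintegral_const_mul'' _ hfm]
      _ ≤ ENNReal.ofReal C₀ * ((∫⁻ x in B, ‖u k x - w x‖ₑ ^ (3 : ℝ)) ^ (1 / (3 : ℝ)) *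
            volume B ^ (1 / (3 / 2 : ℝ))) := mul_le_mul' le_rfl hH
      _ = bnd k := by
          rw [hbnd, hL]
          dsimp only
          rw [show (1 / (3 / 2 : ℝ)) = 2 / 3 by norm_num, mul_comm (_ ^ (1 / (3 : ℝ)))]
          congr 3
          refine lintegral_congr fun x => ?_
          rw [← ENNReal.rpow_natCast]; norm_num
  -- `bnd k → 0`
  have hbnd0 : Tendsto bnd atTop (𝓝 0) := by
    have h1 : Tendsto (fun k => L k ^ (1 / 3 : ℝ)) atTop (𝓝 0) := by
      have h := ((ENNReal.continuous_rpow_const (y := (1 / 3 : ℝ))).tendsto 0).comp hconv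
      rwa [ENNReal.zero_rpow_of_pos (by norm_num)] at h
    have h2 : Tendsto (fun k => volume B ^ (2 / 3 : ℝ) * L k ^ (1 / 3 : ℝ)) atTop (𝓝 0) := by
      have hBtop : volume B ^ (2 / 3 : ℝ) ≠ ⊤ :=
        ENNReal.rpow_ne_top_of_nonneg (by norm_num : (0 : ℝ) ≤ 2 / 3) measure_ball_lt_top.ne
      have h := ENNReal.Tendsto.const_mul h1 (Or.inr hBtop)
      rwa [mul_zero] at h
    have h3 := ENNReal.Tendsto.const_mul h2 (Or.inr (ENNReal.ofReal_ne_top (r := C₀)))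
    rw [mul_zero] at h3
    exact h3
  -- conclusion
  rw [tendsto_iff_norm_sub_tendsto_zero]
  have hbndtop : ∀ᶠ k in atTop, bnd k ≠ ⊤ := (hbnd0.eventually (gt_mem_nhds ENNReal.zero_lt_top)).mono
    fun k hk => hk.ne
  have hre : Tendsto (fun k => (bnd k).toReal) atTop (𝓝 0) := by
    have h := (ENNReal.tendsto_toReal ENNReal.zero_ne_top).comp hbnd0
    rwa [ENNReal.toReal_zero] at h
  refine squeeze_zero' (Eventually.of_forall fun k => norm_nonneg _) ?_ hre
  filter_upwards [hbndtop] with k hk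
  rw [← ENNReal.ofReal_le_iff_le_toReal hk, ofReal_norm]
  exact hkey k

end Pairing

/-! ### The slices of the blow-up limit -/

section Main

variable {v : ℝ → EuclideanSpace ℝ (Fin 3) → EuclideanSpace ℝ (Fin 3)}

set_option maxHeartbeats 1600000 in
/-- **Wang–Zhang 2017, §4 Step 1, (4.4): the slices of the blow-up limit are in
`Ḃ^{-1+3/p}_{p,q}` with norm `≤ M`.** Let `w` be the zoom blow-up limit of `v` about `z₀`
produced by `exists_zoom_blowup_limit` (strong `L³(Q(a))` convergence of
`μ_j v(z₀.1 + μ_j²·, z₀.2 + μ_j·)`, `μ_j = 2^{-(δ(j)+2)}`, to `w`, every `a > 0`), and suppose that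
the slices `v(t)`, `z₀.1 - τ < t < z₀.1`, are represented by realised distributions `V t` of class
`Ḃ^{-1+3/p}_{p,q}` with `‖V t‖ ≤ M` (`3 < p`, `q ≠ 0`), and that `A(R; (0,x))[w] ≤ K` for all `x`
(`R ≥ 3`; `blowup_cknAEss_le_apex`). Then for a.e. `t ∈ ]-R², 0[` the slice `w(t)` is uniformly
locally square integrable and represented by a realised distribution `W ∈ Ḃ^{-1+3/p}_{p,q}` with
`‖W‖ ≤ M`. [cite: WangZhang2016, §4 Step 1 (4.4)] -/
theorem blowup_ae_slice_memHomBesov {z₀ : ℝ × EuclideanSpace ℝ (Fin 3)}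
    (hvm : AEStronglyMeasurable (uncurry v) (volume.restrict (parabolicCylinder (1 / 2) z₀)))
    {p q : ℝ≥0∞} [Fact (1 ≤ p)] (hp : 3 < p) (hq : q ≠ 0) {M : ℝ≥0} {τ : ℝ} (hτ : 0 < τ)
    {V : ℝ → 𝓢'(EuclideanSpace ℝ (Fin 3), EuclideanSpace ℂ (Fin 3))}
    (hV : ∀ t ∈ Ioo (z₀.1 - τ) z₀.1, IsDistributionOf (v t) (V t) ∧
      FunctionSpaces.MemHomBesov (-1 + 3 / p.toReal) p q (V t) ∧
      FunctionSpaces.eHomBesovNorm (-1 + 3 / p.toReal) p q (V t) ≤ M)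
    {δ : ℕ → ℕ} (hδge : ∀ k, k ≤ δ k)
    {w : ℝ → EuclideanSpace ℝ (Fin 3) → EuclideanSpace ℝ (Fin 3)}
    (hwm : ∀ a : ℝ, 0 < a → MemLp (uncurry w) 3
      (volume.restrict (parabolicCylinder a (0 : ℝ × EuclideanSpace ℝ (Fin 3)))))
    (hconv : ∀ a : ℝ, 0 < a → Tendsto (fun j => eLpNorm
        (uncurry (((1 / 2 : ℝ) ^ (δ j + 2)) •
            stPull (((1 / 2 : ℝ) ^ (δ j + 2)) ^ 2) ((1 / 2 : ℝ) ^ (δ j + 2)) z₀.1 z₀.2 v) -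
          uncurry w) 3
        (volume.restrict (parabolicCylinder a (0 : ℝ × EuclideanSpace ℝ (Fin 3)))))
      atTop (𝓝 0))
    {K : ℝ≥0} {R : ℝ} (hR : 3 ≤ R)
    (hA : ∀ x : EuclideanSpace ℝ (Fin 3), cknAEss R ((0 : ℝ), x) w ≤ K) :
    ∀ᵐ t ∂(volume.restrict (Ioo (-R ^ 2) 0)),
      (∃ K' : ℝ≥0, ∀ y : EuclideanSpace ℝ (Fin 3), ∫⁻ z in closedBall y 2, ‖w t z‖ₑ ^ 2 ≤ K') ∧
      ∃ W : 𝓢'(EuclideanSpace ℝ (Fin 3), EuclideanSpace ℂ (Fin 3)),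
        IsDistributionOf (w t) W ∧ FunctionSpaces.MemHomBesov (-1 + 3 / p.toReal) p q W ∧
          FunctionSpaces.eHomBesovNorm (-1 + 3 / p.toReal) p q W ≤ M := by
  obtain ⟨hs, hs0⟩ := neg_two_lt_criticalIndex_and_lt_zero hp
  have hRpos : 0 < R := by linarith
  -- ### the scales and the rescaled fields
  set μ : ℕ → ℝ := fun j => (1 / 2 : ℝ) ^ (δ j + 2) with hμdef
  have hμpos : ∀ j, 0 < μ j := fun j => by positivity
  have hμ0 : Tendsto μ atTop (𝓝 0) := by
    have h1 : Tendsto (fun j : ℕ => (1 / 2 : ℝ) ^ (j + 2)) atTop (𝓝 0) :=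
      (tendsto_pow_atTop_nhds_zero_of_lt_one (by norm_num) (by norm_num)).comp (tendsto_add_atTop_nat 2)
    refine tendsto_of_tendsto_of_tendsto_of_le_of_le tendsto_const_nhds h1 (fun j => (hμpos j).le) fun j => ?_
    exact pow_le_pow_of_le_one (by norm_num) (by norm_num) (by have := hδge j; omega)
  have hμzpow : ∀ j, μ j = (2 : ℝ) ^ (-((δ j + 2 : ℕ) : ℤ)) := fun j => by
    rw [hμdef]; dsimp only; rw [zpow_neg, zpow_natCast, one_div, inv_pow]
  set U : ℕ → ℝ → EuclideanSpace ℝ (Fin 3) → EuclideanSpace ℝ (Fin 3) :=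
    fun j => (μ j) • stPull ((μ j) ^ 2) (μ j) z₀.1 z₀.2 v with hU
  have hUslice : ∀ j t, U j t = fun y => (μ j) • v (z₀.1 + μ j ^ 2 * t) (z₀.2 + (μ j) • y) := by
    intro j t; funext y; rw [hU]; simp only [Pi.smul_apply, stPull_apply]
  -- eventual measurability of the rescaled fields on `Q(a)`
  have hUm : ∀ a : ℝ, 0 < a → ∃ j₀ : ℕ, ∀ j, j₀ ≤ j → AEStronglyMeasurable (uncurry (U j))
      (volume.restrict (parabolicCylinder a (0 : ℝ × EuclideanSpace ℝ (Fin 3)))) := by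
    intro a ha
    obtain ⟨j₀, hj₀⟩ := eventually_scale_mul_le_half hδge ha
    exact ⟨j₀, fun j hj => aestronglyMeasurable_uncurry_zoom_of hvm (hμpos j) ha (hj₀ j hj)⟩
  -- ### the subsequence with a.e. converging slices
  obtain ⟨φ, hφ, hφae⟩ := exists_strictMono_ae_tendsto_slices hUm
    (fun a ha => (hwm a ha).aestronglyMeasurable) hconv
  -- ### the a.e. sets
  set N₀ : ℕ := ⌈R⌉₊ with hN₀
  have hIsub : ∀ n : ℕ, N₀ ≤ n → Ioo (-R ^ 2) (0 : ℝ) ⊆ Ioo (-((n : ℝ) + 1) ^ 2) 0 := by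
    intro n hn
    refine Ioo_subset_Ioo ?_ le_rfl
    have h1 : R ≤ (n : ℝ) + 1 := by
      have := Nat.le_ceil R
      have h2 : (N₀ : ℝ) ≤ n := by exact_mod_cast hn
      rw [hN₀] at h2; linarith
    nlinarith
  -- (1) uniform local square integrability
  have h1 := ae_forall_lintegral_closedBall_sq_le_of_cknAEss hR hA
  -- (2) measurability of the slices of `w`
  have h2 : ∀ᵐ t ∂(volume.restrict (Ioo (-R ^ 2) 0)), ∀ n : ℕ, N₀ ≤ n →
      AEStronglyMeasurable (w t) (volume.restrict (ball (0 : EuclideanSpace ℝ (Fin 3)) ((n : ℝ) + 1))) := by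
    rw [ae_all_iff]
    intro n
    by_cases hn : N₀ ≤ n
    · have hprod : AEStronglyMeasurable (uncurry w)
          ((volume.restrict (Ioo (-((n : ℝ) + 1) ^ 2) 0)).prod
            (volume.restrict (ball (0 : EuclideanSpace ℝ (Fin 3)) ((n : ℝ) + 1)))) := by
        have h := (hwm _ (by positivity : (0 : ℝ) < (n : ℝ) + 1)).aestronglyMeasurable
        rw [parabolicCylinder] at h
        simp only [Prod.fst_zero, Prod.snd_zero, zero_sub] at h
        rwa [Measure.prod_restrict, ← Measure.volume_eq_prod]
      have h := hprod.prodMk_left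
      exact (ae_restrict_of_ae_restrict_of_subset (hIsub n hn) h).mono fun t ht _ => ht
    · exact Eventually.of_forall fun t h => absurd h hn
  -- (3) convergence of the slices along `φ`
  have h3 : ∀ᵐ t ∂(volume.restrict (Ioo (-R ^ 2) 0)), ∀ n : ℕ, N₀ ≤ n →
      Tendsto (fun k => ∫⁻ x in ball (0 : EuclideanSpace ℝ (Fin 3)) ((n : ℝ) + 1),
        ‖U (φ k) t x - w t x‖ₑ ^ (3 : ℕ)) atTop (𝓝 0) := by
    rw [ae_all_iff]
    intro n
    by_cases hn : N₀ ≤ n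
    · exact (ae_restrict_of_ae_restrict_of_subset (hIsub n hn) (hφae n)).mono fun t ht _ => ht
    · exact Eventually.of_forall fun t h => absurd h hn
  -- (4) the window: `z₀.1 - τ < z₀.1 + μ_j² t` for `t > -R²`, `j ≥ j₁`
  have h4 : ∃ j₁ : ℕ, ∀ j, j₁ ≤ j → μ j ^ 2 * R ^ 2 < τ := by
    have ht : Tendsto (fun j => μ j ^ 2 * R ^ 2) atTop (𝓝 (0 ^ 2 * R ^ 2)) := (hμ0.pow 2).mul_const _
    rw [zero_pow two_ne_zero, zero_mul] at ht
    exact (ht.eventually (gt_mem_nhds hτ)).exists_forall_of_atTop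
  obtain ⟨j₁, hj₁⟩ := h4
  filter_upwards [h1, h2, h3, ae_restrict_mem measurableSet_Ioo] with t ht1 ht2 ht3 htI
  -- ### at such a time `t`
  have hKtop : ENNReal.ofReal R * (K : ℝ≥0∞) ≠ ⊤ := ENNReal.mul_ne_top ENNReal.ofReal_ne_top ENNReal.coe_ne_top
  refine ⟨⟨(ENNReal.ofReal R * K).toNNReal, fun y => ?_⟩, ?_⟩
  · rw [ENNReal.coe_toNNReal hKtop]; exact ht1 y
  -- measurability of `w t` on the whole space
  have hwt : AEStronglyMeasurable (w t) volume := by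
    have hcov : (⋃ n : ℕ, ball (0 : EuclideanSpace ℝ (Fin 3)) (((n + N₀ : ℕ) : ℝ) + 1)) = univ := by
      refine eq_univ_of_forall fun x => ?_
      rw [mem_iUnion]
      refine ⟨⌈‖x‖⌉₊, ?_⟩
      rw [mem_ball, dist_zero_right]
      have := Nat.le_ceil ‖x‖
      push_cast
      have h0 : (0 : ℝ) ≤ (N₀ : ℝ) := by positivity
      linarith
    have h := AEStronglyMeasurable.iUnion (μ := volume) (f := w t)
      (s := fun n : ℕ => ball (0 : EuclideanSpace ℝ (Fin 3)) (((n + N₀ : ℕ) : ℝ) + 1))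
      fun n => ht2 (n + N₀) (Nat.le_add_left _ _)
    rwa [hcov, Measure.restrict_univ] at h
  -- integrability of the Schwartz pairings of `w t`
  have hwint : ∀ θ : 𝓢(EuclideanSpace ℝ (Fin 3), ℂ), Integrable (fun x => θ x • complexify (w t x)) :=
    integrable_schwartz_smul_complexify_of_uloc hwt hKtop fun z =>
      (lintegral_mono_set (ball_subset_closedBall.trans (closedBall_subset_closedBall (by norm_num)))).trans
        (ht1 z)
  -- the representation of the rescaled slices, `j ≥ j₁`
  have htime : ∀ j, j₁ ≤ j → z₀.1 + μ j ^ 2 * t ∈ Ioo (z₀.1 - τ) z₀.1 := by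
    intro j hj
    have hμ2 : 0 < μ j ^ 2 := by positivity
    refine ⟨?_, ?_⟩
    · have h := hj₁ j hj
      have : -(μ j ^ 2 * R ^ 2) < μ j ^ 2 * t := by nlinarith [htI.1]
      linarith
    · nlinarith [htI.2]
  set D : ℕ → 𝓢'(EuclideanSpace ℝ (Fin 3), EuclideanSpace ℂ (Fin 3)) := fun j =>
    rescaleDistrib (Units.mk0 ((2 : ℝ) ^ (-((δ j + 2 : ℕ) : ℤ))) (zpow_ne_zero _ two_ne_zero))
      (FunctionSpaces.distribTranslate (EuclideanSpace ℂ (Fin 3)) (-z₀.2) (V (z₀.1 + μ j ^ 2 * t)))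
    with hD
  have hrep : ∀ j, j₁ ≤ j → IsDistributionOf (U j t) (D j) := by
    intro j hj
    have h := (hV _ (htime j hj)).1.rescaleData_translate_add z₀.2
      (Units.mk0 ((2 : ℝ) ^ (-((δ j + 2 : ℕ) : ℤ))) (zpow_ne_zero _ two_ne_zero))
    rw [Units.val_mk0] at h
    have e : U j t = fun y => (2 : ℝ) ^ (-((δ j + 2 : ℕ) : ℤ)) • v (z₀.1 + μ j ^ 2 * t)
        (z₀.2 + ((2 : ℝ) ^ (-((δ j + 2 : ℕ) : ℤ))) • y) := by
      rw [hUslice j t, ← hμzpow j]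
    rw [e]
    exact h
  have hmemD : ∀ j, j₁ ≤ j → FunctionSpaces.MemHomBesov (-1 + 3 / p.toReal) p q (D j) :=
    fun j hj => memHomBesov_zoom z₀.2 _ (hV _ (htime j hj)).2.1
  have hMD : ∀ j, j₁ ≤ j → FunctionSpaces.eHomBesovNorm (-1 + 3 / p.toReal) p q (D j) ≤ M := by
    intro j hj
    rw [hD]
    dsimp only
    rw [eHomBesovNorm_zoom_eq]
    exact (hV _ (htime j hj)).2.2
  -- ### the limit along `n ↦ φ (n + j₁)`
  have hφge : ∀ n, j₁ ≤ φ (n + j₁) := fun n => le_trans (Nat.le_add_left _ _) (hφ.id_le _)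
  have hconvt : ∀ θ : 𝓢(EuclideanSpace ℝ (Fin 3), ℂ), HasCompactSupport (θ : EuclideanSpace ℝ (Fin 3) → ℂ) →
      Tendsto (fun n => ∫ x, θ x • complexify (U (φ (n + j₁)) t x)) atTop
        (𝓝 (∫ x, θ x • complexify (w t x))) := by
    intro θ hθ
    obtain ⟨ρ, hρ⟩ := hθ.isBounded.subset_closedBall (0 : EuclideanSpace ℝ (Fin 3))
    set n : ℕ := max N₀ ⌈ρ⌉₊ with hn
    have hNn : N₀ ≤ n := le_max_left _ _
    have hρn : ρ < (n : ℝ) + 1 := by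
      have := Nat.le_ceil ρ
      have h2 : (⌈ρ⌉₊ : ℝ) ≤ n := by rw [hn]; exact_mod_cast le_max_right _ _
      linarith
    have hsupp : tsupport (θ : EuclideanSpace ℝ (Fin 3) → ℂ) ⊆ ball (0 : EuclideanSpace ℝ (Fin 3)) ((n : ℝ) + 1) :=
      hρ.trans (closedBall_subset_ball hρn)
    refine tendsto_integral_smul_complexify_of_tendsto_lintegral_ball θ hsupp
      (fun k => ((hrep _ (hφge k)) θ).1) (hwint θ)
      (fun k => (IsDistributionOf.aestronglyMeasurable (hrep _ (hφge k))).restrict) (ht2 n hNn) ?_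
    exact (ht3 n hNn).comp (tendsto_add_atTop_nat j₁)
  obtain ⟨W, -, hW, hWmem, hWM⟩ := exists_tendsto_isDistributionOf_of_tendsto_integral hs hs0 p hq
    (u := fun n => U (φ (n + j₁)) t) (U := fun n => D (φ (n + j₁)))
    (fun n => hrep _ (hφge n)) (fun n => hmemD _ (hφge n)) (fun n => hMD _ (hφge n)) hwt hwint hconvt
  exact ⟨W, hW, hWmem, hWM⟩

end Main







end Literature.Analysis.FluidPDE

end
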